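import Summits.CriticalPhenomena.PercolationContinuityZ3.Theorems.PercNearOneGluingNoHeavyLowerTailSahiTransportJRData4

/-!
# `NoHeavyLowerTail` (crux stmt-CriticalPhenomena-4575), Sahi / Kahn positivity: parameter-free transport certificates on `2^4` — evaluation B

Support file (cell `prim-l12`, seat P3, gen 5; `--supports stmt-CriticalPhenomena-4575`).  Computational (`native_decide`): the digit test
`SahiTransportJR.checkTab 33 4 M (certTab4 M)` — structure of the table, every capacity row and all `14 196` transport rows `X ≤ Z` over the `168`
increasing bitmasks of `2^4`, each a `256`-digit base-`2^33` Kronecker-number test — passes for the 28 nontrivial increasing pattern events `M` of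
batch B (`batch4B`).  Six batches A–F cover the `163` events of `2^4` outside the `K₂,₂` orbit; with `…SahiTransportJRSound.sahiE_three_nonneg_of_checkTab`
each gives Kahn's Conjecture 5 / Sahi's `C₃` for that junta first slot, the other two increasing events arbitrary, every dimension. [this work]
-/

namespace Summit.CriticalPhenomena.PercolationContinuityZ3.Theorems.SahiTransportJR

/-- Batch B of certified pattern events of `2^4` (bitmasks over the `16` points). [this work] -/
def batch4B : List ℕ := [52352, 52360, 52416, 52424, 52428, 57344, 57472, 57504, 57536, 57568, 59392, 59520, 59528, 59552, 59560, 59584, 59592, 59616, 59624, 59904, 60032, 60040, 60064, 60072, 60074, 60096, 60104, 60128]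

/-- Every event of batch B passes the certificate check (kernel evaluation via `native_decide`). [this work] -/
theorem checkTab4_batchB : (batch4B.all fun M => checkTab 33 4 M (certTab4 M)) = true := by native_decide

/-- Pointwise form. [this work] -/
theorem checkTab4_of_mem_batchB {M : ℕ} (h : M ∈ batch4B) : checkTab 33 4 M (certTab4 M) = true :=
  List.all_eq_true.1 checkTab4_batchB M h

end Summit.CriticalPhenomena.PercolationContinuityZ3.Theorems.SahiTransportJR
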